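import Mathlib
import Summits.Ventures.PercRepro.TriangleCapUpperZoneBound
import Summits.Ventures.PercRepro.TriangleCapStarFamilyTwoWitness
import Summits.Ventures.PercRepro.TriangleCapNearRegular

/-!
# PercRepro — THE EXACT BOTTOM ONE BELOW THE THRESHOLD OF THE UPPER REGIME (p3, gen 57; part 344)

`D + 1 ≤ 2 r`, `ρ = D − r ≥ 2`, `X = D − 2 ρ`, `m = D + r − 3` (one below the threshold `m ≥ D + r − 2` of
part 319), `t = m D + r`, `m + 1 ≤ ℓ`, `2 t ≤ s`.  On `ℓ + 1 + (s − t)` vertices THE BOTTOM OF THE DEEP SUB-BAND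
`u = t − D` ON ALL GRAPHS IS `C(t,2) − t (D − 1) + min(r (D − r), ρ (X + 1) + E/2)` with `E = 2 X − 2` for `X ≥ 2`
(`upper_zone_one_below_exact_wide`) and `E = 4 ρ − 2`, i.e. the value `min(2 r (D − r), 4 D − 6)`, for `X = 1`
(`upper_zone_one_below_exact_tight`): the lower bound is part 338; the bipartite value is attained by the
near-regular witness of part 307, the star value by THE TWO-SHORT STAR FAMILY of part 343 — `a = ρ` specials,
`Rc = r` centre rows with the first two short by `D − 1` and `2 ρ + 1`, `Q = 2 r − 3` regular columns and no extra
row (`I = ρ`) in the wide regime; `a = ρ − 1`, `Rc = r`, both short rows of size `1`, `Q = D − 1` (`I = ρ − 1`, the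
centre a partial column of degree `D − 1`) in the tight regime.  Below the bipartite value as soon as
`X − 1 < ρ (ρ − 1)` resp. `ρ ≥ 3`: `(D, r, m) = (6, 4, 7)`: `14 < 16`; `(7, 4, 8)`: `22 < 24`; `(8, 5, 10)`: `20 < 30`.
Axioms: standard.
-/

namespace PercRepro

namespace TriangleCap

namespace C047

open Finset

/-- The two-short star family one below the threshold, wide regime: the value
`2 ρ + (D − 1) + (D − 2 ρ − 1)(2 ρ + 1) = 2 ρ (D − 2 ρ + 1) + (2 (D − 2 ρ) − 2)`. -/
theorem wide_value_arith (D r : ℕ) (h1 : D + 2 ≤ 2 * r) (h2 : r + 2 ≤ D) :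
    2 * (D - r) + ((r + (D - r)) * (D - (r + (D - r))) +
      ((D - (D - 1)) * (D - 1) + (D - (2 * (D - r) + 1)) * (2 * (D - r) + 1))) =
      2 * ((D - r) * (D - 2 * (D - r) + 1)) + (2 * (D - 2 * (D - r)) - 2) := by
  obtain ⟨ρ, rfl⟩ : ∃ ρ, D = r + ρ := ⟨D - r, by omega⟩
  obtain ⟨X, rfl⟩ : ∃ X, r = ρ + X + 2 := ⟨r - ρ - 2, by omega⟩
  have e1 : ρ + X + 2 + ρ - (ρ + X + 2) = ρ := by omega
  have e2 : ρ + X + 2 + ρ - (ρ + X + 2 + ρ) = 0 := by omega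
  have e3 : ρ + X + 2 + ρ - (ρ + X + 2 + ρ - 1) = 1 := by omega
  have e4 : ρ + X + 2 + ρ - 1 = 2 * ρ + X + 1 := by omega
  have e5 : ρ + X + 2 + ρ - (2 * ρ + 1) = X + 1 := by omega
  have e6 : ρ + X + 2 + ρ - 2 * ρ + 1 = X + 3 := by omega
  have e7 : 2 * (ρ + X + 2 + ρ - 2 * ρ) - 2 = 2 * X + 2 := by omega
  rw [e1, e2, e3, e4, e5, e6, e7]
  ring

/-- The two-short star family one below the threshold, tight regime `D = 2 r − 1`: the value
`2 (r − 2) + (2 r − 2) · 1 + 2 (D − 1) = 4 D − 6`. -/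
theorem tight_value_arith (D r : ℕ) (h1 : D + 1 = 2 * r) (h2 : r + 2 ≤ D) :
    2 * (r - 2) + ((r + (r - 2)) * (D - (r + (r - 2))) + ((D - (D - 1)) * (D - 1) + (D - (D - 1)) * (D - 1))) =
      4 * D - 6 := by
  obtain ⟨r', rfl⟩ : ∃ r', r = r' + 3 := ⟨r - 3, by omega⟩
  have hD : D = 2 * r' + 5 := by omega
  subst hD
  have e1 : r' + 3 - 2 = r' + 1 := by omega
  have e2 : 2 * r' + 5 - (r' + 3 + (r' + 1)) = 1 := by omega
  have e3 : 2 * r' + 5 - (2 * r' + 5 - 1) = 1 := by omega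
  have e4 : 2 * r' + 5 - 1 = 2 * r' + 4 := by omega
  have e5 : 4 * (2 * r' + 5) - 6 = 8 * r' + 14 := by omega
  rw [e1, e2, e3, e4, e5]
  ring

/-- **THE EXACT BOTTOM ONE BELOW THE THRESHOLD, WIDE REGIME `D ≥ 2 ρ + 2`:** for `D + 2 ≤ 2 r`, `r + 2 ≤ D`,
`ρ = D − r`, `m + 3 = D + r`, `t = m D + r`, `m + 1 ≤ ℓ`, `2 t ≤ s`: every graph on `ℓ + 1 + (s − t)` vertices with a
vertex of degree `s − t` and every off-degree `≤ D` has
`t (t − 1) + min(2 r (D − r), 2 ρ (D − 2 ρ + 1) + (2 (D − 2 ρ) − 2)) ≤ 2 j + 2 t (D − 1)`, and a graph of the band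
with maximum off-degree exactly `D` attains it — the bottom is
`C(t,2) − t (D − 1) + min(r (D − r), ρ (D − 2 ρ + 1) + (D − 2 ρ − 1))`. -/
theorem upper_zone_one_below_exact_wide (s ℓ m r D : ℕ) (h1 : D + 2 ≤ 2 * r) (h2 : r + 2 ≤ D)
    (hm : m + 3 = D + r) (hmℓ : m + 1 ≤ ℓ) (hs : 2 * (m * D + r) ≤ s) :
    (∀ (H : SimpleGraph (Fin (ℓ + 1 + (s - (m * D + r))))) [DecidableRel H.Adj], H.CliqueFree 3 →
      H.edgeFinset.card = s → ∀ w, deg H w + (m * D + r) = s → (∀ v, offDeg H w v ≤ D) →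
      ∀ j, ∑ v, deg H v * deg H v + 2 * ((m * D + r) * (s - (m * D + r) - 1)) + 2 * j = s * (s + 1) →
      (m * D + r) * (m * D + r - 1) +
          min (2 * (r * (D - r))) (2 * ((D - r) * (D - 2 * (D - r) + 1)) + (2 * (D - 2 * (D - r)) - 2)) ≤
        2 * j + 2 * ((m * D + r) * (D - 1))) ∧
    (∃ (H : SimpleGraph (Fin (ℓ + 1 + (s - (m * D + r))))) (_ : DecidableRel H.Adj), H.CliqueFree 3 ∧
      H.edgeFinset.card = s ∧ ∃ w, deg H w + (m * D + r) = s ∧ (∀ v, offDeg H w v ≤ D) ∧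
        (∃ x, ¬ H.Adj w x ∧ offDeg H w x = D) ∧
        ∃ j, ∑ v, deg H v * deg H v + 2 * ((m * D + r) * (s - (m * D + r) - 1)) + 2 * j = s * (s + 1) ∧
          2 * j + 2 * ((m * D + r) * (D - 1)) = (m * D + r) * (m * D + r - 1) +
            min (2 * (r * (D - r))) (2 * ((D - r) * (D - 2 * (D - r) + 1)) + (2 * (D - 2 * (D - r)) - 2))) := by
  have hD0 : 0 < D := by omega
  constructor
  · intro H _ hfree hsH w hw hD' j hj
    have hw1 : 1 ≤ deg H w := by
      have : 0 < m * D := Nat.mul_pos (by omega) (by omega)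
      omega
    exact upper_zone_bound_wide H hfree s m r D j h1 h2 hm hsH w hw hw1 hj hD'
  · rcases Nat.lt_or_ge (2 * ((D - r) * (D - 2 * (D - r) + 1)) + (2 * (D - 2 * (D - r)) - 2)) (2 * (r * (D - r)))
      with hmin | hmin
    swap
    · -- the bipartite value: the near-regular witness of part 307
      rw [min_eq_left hmin]
      obtain ⟨H, inst, hfree, -, hcard, w, hw, hD', hx, j, hj, hval⟩ :=
        nearRegularWitness s ℓ m r D (by omega) (by omega) (by omega) hmℓ hs
      refine ⟨H, inst, hfree, hcard, w, hw, hD', hx, j, hj, ?_⟩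
      rw [hval, show m * D + r = D * m + r by ring, phiD_mul_add, phiD_of_lt D r (by omega)]
    · -- the two-short star family: `a = ρ`, `Rc = r`, `sh0 = D − 1`, `sh1 = 2 ρ + 1`, `E = 0`, `Q = 2 r − 3`
      rw [min_eq_right hmin.le]
      have ht : m * D + r = r + (D - r) * (D - 1) + (2 * r - 3) * D + (D - r) := by
        obtain ⟨ρ, rfl⟩ : ∃ ρ, D = r + ρ := ⟨D - r, by omega⟩
        obtain ⟨r', rfl⟩ : ∃ r', r = r' + 3 := ⟨r - 3, by omega⟩
        have hm' : m = r' + 3 + ρ + r' := by omega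
        subst hm'
        have e1 : r' + 3 + ρ - (r' + 3) = ρ := by omega
        have e2 : r' + 3 + ρ - 1 = r' + ρ + 2 := by omega
        have e3 : 2 * (r' + 3) - 3 = 2 * r' + 3 := by omega
        rw [e1, e2, e3]
        ring
      have hinc : r * (D - 1) + (D - 1) * (D - (D - r)) + 0 * D = (2 * r - 3) * D + (D - 1 + (2 * (D - r) + 1)) := by
        obtain ⟨ρ, rfl⟩ : ∃ ρ, D = r + ρ := ⟨D - r, by omega⟩
        obtain ⟨r', rfl⟩ : ∃ r', r = r' + 3 := ⟨r - 3, by omega⟩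
        have e1 : r' + 3 + ρ - (r' + 3) = ρ := by omega
        have e2 : r' + 3 + ρ - 1 = r' + ρ + 2 := by omega
        have e3 : 2 * (r' + 3) - 3 = 2 * r' + 3 := by omega
        have e4 : r' + 3 + ρ - ρ = r' + 3 := by omega
        rw [e1, e2, e3, e4]
        ring
      obtain ⟨H, inst, hfree, hcard, w, hw, hD', hx, j, hj, hval⟩ :=
        starFamilyTwoWitness s ℓ (m * D + r) D (D - r) r (D - 1) (2 * (D - r) + 1) 0 (2 * r - 3) ht (by omega)
          (by omega) (by omega) (by omega) (by omega) (by omega) (by omega) (fun h => by omega) hinc (by omega) hs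
      refine ⟨H, inst, hfree, hcard, w, hw, hD', hx, j, hj, ?_⟩
      rw [hval, ← wide_value_arith D r h1 h2]
      ring

/-- **THE EXACT BOTTOM ONE BELOW THE THRESHOLD, TIGHT REGIME `D = 2 ρ + 1`:** for `D + 1 = 2 r`, `r + 2 ≤ D`,
`m + 3 = D + r`, `t = m D + r`, `m + 1 ≤ ℓ`, `2 t ≤ s`: every graph on `ℓ + 1 + (s − t)` vertices with a vertex of
degree `s − t` and every off-degree `≤ D` has `t (t − 1) + min(2 r (D − r), 4 D − 6) ≤ 2 j + 2 t (D − 1)`, and a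
graph of the band with maximum off-degree exactly `D` attains it — the bottom is
`C(t,2) − t (D − 1) + min(r (D − r), 2 D − 3)`. -/
theorem upper_zone_one_below_exact_tight (s ℓ m r D : ℕ) (h1 : D + 1 = 2 * r) (h2 : r + 2 ≤ D)
    (hm : m + 3 = D + r) (hmℓ : m + 1 ≤ ℓ) (hs : 2 * (m * D + r) ≤ s) :
    (∀ (H : SimpleGraph (Fin (ℓ + 1 + (s - (m * D + r))))) [DecidableRel H.Adj], H.CliqueFree 3 →
      H.edgeFinset.card = s → ∀ w, deg H w + (m * D + r) = s → (∀ v, offDeg H w v ≤ D) →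
      ∀ j, ∑ v, deg H v * deg H v + 2 * ((m * D + r) * (s - (m * D + r) - 1)) + 2 * j = s * (s + 1) →
      (m * D + r) * (m * D + r - 1) + min (2 * (r * (D - r))) (4 * D - 6) ≤
        2 * j + 2 * ((m * D + r) * (D - 1))) ∧
    (∃ (H : SimpleGraph (Fin (ℓ + 1 + (s - (m * D + r))))) (_ : DecidableRel H.Adj), H.CliqueFree 3 ∧
      H.edgeFinset.card = s ∧ ∃ w, deg H w + (m * D + r) = s ∧ (∀ v, offDeg H w v ≤ D) ∧
        (∃ x, ¬ H.Adj w x ∧ offDeg H w x = D) ∧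
        ∃ j, ∑ v, deg H v * deg H v + 2 * ((m * D + r) * (s - (m * D + r) - 1)) + 2 * j = s * (s + 1) ∧
          2 * j + 2 * ((m * D + r) * (D - 1)) =
            (m * D + r) * (m * D + r - 1) + min (2 * (r * (D - r))) (4 * D - 6)) := by
  have hD0 : 0 < D := by omega
  constructor
  · intro H _ hfree hsH w hw hD' j hj
    have hw1 : 1 ≤ deg H w := by
      have : 0 < m * D := Nat.mul_pos (by omega) (by omega)
      omega
    exact upper_zone_bound_tight H hfree s m r D j h1 h2 hm hsH w hw hw1 hj hD'
  · rcases Nat.lt_or_ge (4 * D - 6) (2 * (r * (D - r))) with hmin | hmin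
    swap
    · rw [min_eq_left hmin]
      obtain ⟨H, inst, hfree, -, hcard, w, hw, hD', hx, j, hj, hval⟩ :=
        nearRegularWitness s ℓ m r D (by omega) (by omega) (by omega) hmℓ hs
      refine ⟨H, inst, hfree, hcard, w, hw, hD', hx, j, hj, ?_⟩
      rw [hval, show m * D + r = D * m + r by ring, phiD_mul_add, phiD_of_lt D r (by omega)]
    · -- the two-short star family: `a = r − 2`, `Rc = r`, `sh0 = sh1 = D − 1`, `E = 0`, `Q = D − 1`
      rw [min_eq_right hmin.le]
      have ht : m * D + r = r + (r - 2) * (D - 1) + (D - 1) * D + (r - 2) := by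
        obtain ⟨r', rfl⟩ : ∃ r', r = r' + 3 := ⟨r - 3, by omega⟩
        have hD : D = 2 * r' + 5 := by omega
        have hm' : m = 3 * r' + 5 := by omega
        subst hD hm'
        have e1 : r' + 3 - 2 = r' + 1 := by omega
        have e2 : 2 * r' + 5 - 1 = 2 * r' + 4 := by omega
        rw [e1, e2]
        ring
      have hinc : r * (D - 1) + (D - 1) * (D - (r - 2)) + 0 * D = (D - 1) * D + (D - 1 + (D - 1)) := by
        obtain ⟨r', rfl⟩ : ∃ r', r = r' + 3 := ⟨r - 3, by omega⟩
        have hD : D = 2 * r' + 5 := by omega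
        subst hD
        have e1 : r' + 3 - 2 = r' + 1 := by omega
        have e2 : 2 * r' + 5 - 1 = 2 * r' + 4 := by omega
        have e3 : 2 * r' + 5 - (r' + 1) = r' + 4 := by omega
        rw [e1, e2, e3]
        ring
      obtain ⟨H, inst, hfree, hcard, w, hw, hD', hx, j, hj, hval⟩ :=
        starFamilyTwoWitness s ℓ (m * D + r) D (r - 2) r (D - 1) (D - 1) 0 (D - 1) ht (by omega) (by omega)
          (by omega) (by omega) (by omega) (by omega) (by omega) (fun h => by omega) hinc (by omega) hs
      refine ⟨H, inst, hfree, hcard, w, hw, hD', hx, j, hj, ?_⟩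
      rw [hval, ← tight_value_arith D r h1 h2]
      ring

end C047

end TriangleCap

end PercRepro
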